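import Summits.QuantumFields.BalabanUV.T4Continuum.Support.ShellMeasureLandauEndAssembledDecayCfLinCoTestsSchurV6
import Summits.QuantumFields.BalabanUV.T4Continuum.Support.ShellMeasureRayTermsPinnedLower

/-!
v6 RE-ROOT (owner R-ne7cp1-g37-1 (c3) «THE MIDDLE», unit `b2b-balaban-t4-ne7c-formalise-leaf-03` gen 9; chain suffix `V6`∕`_v6`,
R-ne7cp1-g37-3 (b)): THIS MODULE IS `ShellMeasureLandauEndAssembledDecayCfLinCoTestsSchurElb` (ROW S108 f3, leaf-07-g10) REGENERATED MECHANICALLY over link 6 `ShellMeasureLandauEndAssembledDecayCfLinCoTestsSchurV6` — the chain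
rooted at leaf-07-g10's S112 f3 `ShellMeasureLandauEndRayStokesAssembledDecayV6` (the Wilson budgets `hqW hk` in print's (53)–(54)
field-size shape, S112; the 𝓔-leg read on the w-tuple's pinned dress, S113 = leaf-01-g11's `ShellMeasureRayTermsPinnedLandauW`) — by
`g9/src/relink/relink.py` (the old surgery re-applied to the new host; ONE BY-NAME call; conclusion = the host's).  BINDER DIFF vs `ShellMeasureLandauEndAssembledDecayCfLinCoTestsSchurElb` (`linkdiff.py` on the bytes):
LEAVE = `Se Se' h52loce ϖe₁ ϖe₂ hϖe₁ hϖe₂ r₀e hreache Λe 𝔄 δ' ϖ hδ' hϖ 𝒵e ℬe 𝒢e W𝒱e B₀e C₄e a₃e be h𝒢e hWe hB₀e hC₄e hbe H₁e hH₁e Te rΦe hTbe hSre ιe hιe He hHe`;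
ENTER = `hϖ0 hιew`; TYPE-CHANGED = `hqW hk hdome hselfe hcontre hqe hRCe Ef hEb supp hblind hdepth hK hcoupE hRdict`; conclusion = the
host's re-spelled slot constant.  HAND-SPOT (announced): `hElb₁` is DERIVED per exterior section by leaf-01-g11's S113 f2 `ShellMeasureRayTermsPinnedLandauW.hElb_landau_chartRay_pinned_w` (S108 f3a fired at the w-instances) with R10's LINEAR `Tw` (`ShellMeasureLinearChartMap.hΦd∕hΦ0∕hΦ_of_linear`) and link 3's pinned pair `hRe`; `BE₁ := Σ_{i∈I} ee i`; NOTHING displayed in its place.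
HONEST (c3): re-wiring of OUR typed chain; nothing of Bałaban's asserted, cited or discharged; every CONTENT row stays displayed; NOTHING
in the countdown moves; NE7c NOT PRINTED, NOT PROVED; spine 0∕9.  THE OLD MODULE's DOCSTRING FOLLOWS VERBATIM FOR PROVENANCE (read
«imports X» as «imports X·V6»; its LEAVING∕ENTERING lists describe the OLD step, unchanged relative to the v6 host).
# `T4Continuum.ShellMeasureLandauEndAssembledDecayCfLinCoTestsSchurElb` — row S108 f3 (the junction wave's LINK (2), owner
# R-ne7cp1-g36-12): S108 f2 `…CfLinCoTestsSchur._cfB7_lin_coTests_schur` BY NAME with the non-Wilson leg's lower-bound row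
# `hElb₁` DERIVED from its displayed neighbours `hEb` + `hcoupE` — LEAVING `hElb₁` (+ the letter `BE₁`; census R15b, 1 [T] W-b),
# ENTERING NOTHING; conclusion IDENTICAL
(cell `pub-balaban`, sub-cell `t4`, spine estimate NE7c (node U5b); NE7c ROUND-2 crew, unit `b2b-balaban-t4-ne7c-formalise-leaf-07`
gen 10; owner table `t4/b2b-balaban-t4-ne7c-p1/LEAVES-NE7c-P1.md` row **S108 f3** (RULING R-ne7cp1-g36-12 (2), on this unit's OFFER
O-ne7cleaf07g10-1); ADDITIVE — imports S108 f2 `ShellMeasureLandauEndAssembledDecayCfLinCoTestsSchur` (leaf-04-g11: link (1), the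
w-tuple's three sup-norm operator rows by Schur + the three sign rows `he0 hLK hBd0`) and S108 f3a `ShellMeasureRayTermsPinnedLower`
(this unit, p238754: `hElb_landau_chartRay_pinned_linear`) ONLY; [folklore]; 0 `def`, 0 `def … : Prop`, 0 sorry, 0 citation tags;
signature + call generated mechanically from link (1)'s bytes by `gen_f3b.py` — the host's explicit binders passed IN ORDER, by name)

HONEST FRAMING.  Finite four-torus programme, rung (B)+1 only — NOT infinite volume, NOT a mass gap, NOT the Clay problem, NOT summit
progress; (B), `BetaPertHyp`, (B^μ) not consumed.  NE7c (`T4IndicatorShell.ShellWeightBound`) is NOT PRINTED in [Balaban 1983–89] and NOT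
PROVED; «NE7c ⇐ the named binders» (trigger c3): every binder below is DISPLAYED, asserted by nobody; the Bałaban-type CONTENT rows
(propagator∕(P4)∕linear maps, decay kernels, the sectioned non-Wilson terms `hEd hEb hblind hdepth hK`, the dressed integral's
`hint hpos hA hElb₂`, the located background regularity, the neighbours' (AN-bound)) REMAIN.  HONEST DEPENDENCY (cell): continuum YM on
T⁴ ⇐ BetaPertH ∧ nine spine estimates (0/9 proved); BetaPertH ⇐ (D1) ∧ (D4) ∧ CAP+tail; G-an2-4 gates asym, D1 and NE2/3/4.

THE POINT (O-ne7cleaf07g10-1; the owner's principle (α) of R-ne7cp1-g36-12: «a displayed hypothesis may LEAVE if it is a logical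
consequence of OTHER displayed hypotheses»).  Link (1) carries, for the e-tuple (S71 f2's located non-Wilson terms), the binder
`hElb₁ : ∀ V (y : Fin m₀ → ℝ), ‖y‖ ≤ S → −BE₁ ≤ (Σ_{i∈I} Ef i (toPiL (Z_V y))).re` with a FREE letter `BE₁ : ℝ` — used
downstream ONLY in END-II's finiteness proviso (`h𝓔lb` ↦ `hfin_of_cubeBound … e^{BE₁+BE₂}` in `ShellMeasureLandauEndRayStokes` l.303–309), never in
the slot constant.  The SAME signature displays `hEb : ∀ i ∈ I, ∀ Z ∈ ball 0 r_E, ‖Ef i Z‖ ≤ ee i` and the located coupling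
`hcoupE : z̄_e ≤ r_E∕2`, which put the exponent field's flat image inside `ball 0 (r_E∕2)` (S71 f2's own step); hence at every real
chart point `‖y‖ ≤ S`: `Re Σ Ef i (…) ≥ −Σ_{i∈I} ee i`.  THIS FILE:
**`slotAC_realized_su2_landauChart_assembled_decay_cfB7_lin_coTests_schur_elb`** = link (1) with `hElb₁` PROVED in-proof at
`BE₁ := Σ_{i∈I} ee i` — two `have`s: the e-tuple's pinned Landau-correction pair `hRe` (S99 f3b l.330–336 VERBATIM:
`landauCorrection_binders_local` on the boxes `h52loce` ∘ CfP `conj_binders_of_local` with S68 (b)'s `landauCf_congr` and the reach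
`hreache`), then f3a `hElb_landau_chartRay_pinned_linear … Te hTbe … I hEb hcoupE`; then ONE call of (1) BY NAME.
LEAVING (vs link (1)): `{BE₁ : ℝ} (hElb₁ : …)` — 1 hypothesis [T] (W-b, R15b) + 1 data letter.  ENTERING: nothing.  Every other
binder VERBATIM (types token-identical); CONCLUSION IDENTICAL.  Census arithmetic is the owner's two engines' (expected T −1).
G-1: no new family enters — link (1)'s in-file numeric instance and S104 f3∕f4's witnesses apply unchanged (pointer).
WHAT THIS DOES NOT DO.  Discharge `hEb`, `hcoupE`, `hElb₂` or any W-b CONTENT row; assert a reading; CONDITIONAL on every binder;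
NOT Bałaban's minimiser (node O); (M1) realized ≠ NE7c; NOTHING in the countdown moves; NE7c NOT PROVED; spine PROVED 0∕9.
-/

noncomputable section

open Set Metric NormedSpace MeasureTheory Function

namespace Summit.QuantumFields.BalabanUV.T4Continuum.ShellMeasureLandauEndAssembledDecayCfLinCoTestsSchurElbV6

open scoped ENNReal
open Literature.MathematicalPhysics.QuantumFieldTheory.Balaban1983to89
open B11Prop6Scheme (Prop4Hyp)
open GaugeField (GaugeInvariant)
open T4ShellMeasure (SlotAntiConcentration)
open T4CubePoincare (cube)
open T4CubeChartGnomonic (SU2)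
open T4CubeChartExp (expFibreChart)
open T4TreeGaugeFixing (NoClosedLoop fixTo noClosedLoop_combBonds)
open T4ShellMeasurePlaquette (expTail₂)
open ShellMeasureLevelAssembly (classifier)
open ShellMeasureMultiGridNorms (WSup)
open ShellMeasurePinnedNorm (pinW kerOpPin)
open ShellMeasureMultiGridNorms.WSup (toPiL)
open ShellMeasureLandauHolonomy (solAt landauExp)
open ShellMeasureLandauHolonomyChart (holOf cplx)
open ShellMeasureLandauHolonomySkew (readOutReal)
open ShellMeasureRayTermsPinnedLandauW (hE_landau_chartRay_pinned_w)
open ShellMeasureRayLogIntegral (rayBound_of_logIntegral rayBound_add)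
open ShellMeasureLandauEndFinal (slotAC_realized_su2_landauChart_final)
open ShellMeasureLandauEndRayStokesAssembled (wilsonProfile_nonneg)
open ShellMeasureDecayKernelSums (kerOp)
open ShellMeasureLandauWilsonSquaresKernelsSchwarzField (hE_landau_wilsonSquares_located_schwarz_of_decay_field)
open ShellMeasureRayTermsPinnedLandau (hE_landau_chartRay_pinned completeSpace_wsup)
open ShellMeasureLandauEndWindowRestrictRel (slotAC_realized_su2_landauChart_final_of_reach')
open T4AxialGaugeSmallField (boxPlaqs boxBonds)
open T4AxialGaugeFixing (combBonds)
open ShellMeasureWindowReachCollar (hreach'_of_core_collar)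
open ShellMeasureLandauEndWindowReach (reach_family_inhabited)
open ShellMeasureLevelZeroBoxWitness (toyParams blockBonds boxPlaqF)
open ShellMeasureLandauEndAssembledDecayReachV6 (slotAC_realized_su2_landauChart_assembled_decay_v6_of_reach')
open B7Prop2Explicit (C0 c2' unitaryUnits avgClosed_unitaryUnits)
open B7Prop1Local (pdevOn loK bondHiK)
open B7Prop5Flat (BondIn)
open ShellMeasureAverageProp4General (C1cov O1cov C2cov C1cov_pos)
open ShellMeasureLandauCorrectionB7 (landauCf landauRad)
open ShellMeasureLandauCorrectionReal (skewPi isClosed_skewPi)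
open ShellMeasureLandauCfBoxLocal (landauCfBox landauCfBox_local landauCfBox_real_binders_local)
open ShellMeasureLandauCorrectionB7Local (landauCorrection_real_binders_flat landauCorrection_binders_local)
open ShellMeasureAverageLocality148 (landauCf_congr)
open ShellMeasureLandauCfPinned (conj_binders_of_local C2cov_nonneg)
open ShellMeasureLandauEndAssembledDecayReachBoxV6 (slotAC_realized_su2_landauChart_assembled_decay_v6_of_core_collar)
open ShellMeasureLinearChartMap (hΦd_of_linear hΦ0_of_linear hΦ_of_linear hΦr_of_linear)
open ShellMeasureLandauEndAssembledDecayCfV6 (slotAC_realized_su2_landauChart_assembled_decay_v6_cfB7)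
open ShellMeasureCoTestStarShaped (jco_triple_of_neighbours)
open ShellMeasureLandauEndAssembledDecayCfLinV6 (slotAC_realized_su2_landauChart_assembled_decay_v6_cfB7_lin)
open ShellMeasureDecayKernelSchur (norm_kerOp_le_of_decay_junction_family)
open ShellMeasureLandauEndAssembledDecayCfLinCoTestsV6 (slotAC_realized_su2_landauChart_assembled_decay_v6_cfB7_lin_coTests)
open ShellMeasureRayTermsPinnedLower (hElb_landau_chartRay_pinned_linear)
open ShellMeasureLandauEndAssembledDecayCfLinCoTestsSchurV6 (slotAC_realized_su2_landauChart_assembled_decay_v6_cfB7_lin_coTests_schur)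

section Box

open scoped Matrix.Norms.L2Operator

variable {P : Params} {j : ℕ} [DecidableEq (PBond P j)]
variable {n : Type*} [Fintype n] [DecidableEq n] [Nonempty n]
variable {𝒴 𝒵 ℬ : Type*} [NormedAddCommGroup 𝒴] [NormedSpace ℂ 𝒴] [CompleteSpace 𝒴]
  [NormedAddCommGroup 𝒵] [NormedSpace ℂ 𝒵] [NormedAddCommGroup ℬ] [NormedSpace ℂ ℬ]
variable {𝔸 : Type*} [CStarAlgebra 𝔸] [Nontrivial 𝔸]

/-- **LINK (2) OF THE JUNCTION WAVE — S108 f2 WITH `hElb₁` DERIVED** (row S108 f3; module docstring): the most-assembled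
one-slot END with R11, R10, R05, the w-tuple's Schur rows and the (T3)∕(S78) sign rows supplied (link (1), leaf-04-g11) AND the
non-Wilson leg's lower bound `hElb₁` proved from `hEb` + `hcoupE` at `BE₁ := Σ_{i∈I} ee i` (f3a).  Signature = link (1)'s minus
`{BE₁} (hElb₁ …)`; conclusion IDENTICAL; proof = `hRe` (S99 f3b's e-tuple pair, by name) + `hElb_landau_chartRay_pinned_linear` + ONE
call of `slotAC_realized_su2_landauChart_assembled_decay_cfB7_lin_coTests_schur`.  CONDITIONAL on every displayed binder; nothing PRINTED
asserted; NOT Bałaban's minimiser. [folklore] -/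
theorem slotAC_realized_su2_landauChart_assembled_decay_v6_cfB7_lin_coTests_schur_elb
    -- the BOX `[lo, hi]` (the block `□^{∼4}`: `nb` unit steps per direction, non-wrapping on the torus) and its axial comb
    {lo hi : Fin P.d → ℤ} {nb : ℕ} (hn : ∀ κ, hi κ ≤ lo κ + nb) (hN : ∀ κ, hi κ - lo κ < P.sitesPerDir j)
    (Λ : Finset (PBond P j)) (hΛbox : ∀ b ∈ Λ, b ∈ boxBonds lo hi) (hΛcomb : Disjoint Λ (combBonds lo hi)) {m₀ : ℕ}
    (e : ↥Λ × Fin 3 ≃ Fin m₀) {S : ℝ} (hS : 0 < S) (hSπ : 3 * S ^ 2 < Real.pi ^ 2) {F : GaugeField P j SU2 → ℝ≥0∞}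
    (hF : Measurable F) (hFi : GaugeInvariant F) {u : GaugeField P j SU2 → ℝ} (hu : Measurable u)
    (hui : GaugeInvariant u) {ι : Type*} {Pu : Finset ι} (hPu : Pu.Nonempty)
    -- ══ R05 SUPPLIED (this file): window `W V := closedBall 0 S`, co-test `Jco V :=` the NEIGHBOURS' KEPT (2.17)-indicators on the
    -- S-ball (S94 `ShellMeasureCoTestStarShaped.jco_triple_of_neighbours`) — `hJW hJ hJ1 hWS` DISCHARGED; DISPLAYED in their place the
    -- per-neighbour families: neighbours `N`, plaquettes `PuN`, holonomies `holN` read on OUR chart, thresholds∕radii∕bounds∕deltas,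
    -- (SM)_i in S94's currency, and (AN-bound)_i on our rays (W-a TYPE — the straddling cubes' localized minimisers; displayed) ══
    {κN : Type*} (N : Finset κN) {ιN : κN → Type*} {PuN : (i : κN) → Finset (ιN i)} (hPuN : ∀ i, (PuN i).Nonempty)
    {AN : Type*} [NormedRing AN] [NormedAlgebra ℂ AN] [CompleteSpace AN]
    (holN : (i : κN) → GaugeField P j SU2 → ιN i → (Fin m₀ → ℝ) → AN) {θN RN HN δN : κN → ℝ} (hRN : ∀ i ∈ N, 1 < RN i)
    (hθN : ∀ i ∈ N, 0 < θN i) (hδ0N : ∀ i ∈ N, 0 ≤ δN i) (hδ1N : ∀ i ∈ N, δN i ≤ 1)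
    (hSMN : ∀ i ∈ N, 36 * HN i * 1 ^ 2 / (RN i - 1) ^ 2 ≤ δN i * θN i)
    (hANN : ∀ i ∈ N, ∀ V, ∀ x ∈ closedBall (0 : Fin m₀ → ℝ) S, ∀ p ∈ PuN i, ∃ f : ℂ → AN,
      DifferentiableOn ℂ f (ball 0 (RN i)) ∧ (∀ w ∈ ball (0 : ℂ) (RN i), ‖f w‖ ≤ HN i) ∧ f 0 = 0 ∧
      ∀ c : ℝ, 0 ≤ c → c ≤ 1 → f (c : ℂ) = holN i V p (c • x) - 1)
    {δ ρ β : ℝ} (𝒢 : GaugeField P j SU2 → (𝒵 →L[ℂ] 𝒴)) (W𝒱 : GaugeField P j SU2 → 𝒴 → 𝒵) {B₀ C₄ a₃ ε₄ : ℝ}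
    (h𝒢 : ∀ V f, ‖𝒢 V f‖ ≤ B₀ * ‖f‖) (hW : ∀ V, Prop4Hyp (W𝒱 V) C₄ a₃) (hB₀ : 0 < B₀) (hC₄ : 0 ≤ C₄) (hε₄ : 0 ≤ ε₄)
    {dL C₁ B₃ ε₁ : ℝ} (hdL : 0 ≤ dL) (hC₁ : 0 ≤ C₁) (hε₁ : 0 ≤ ε₁) (hB₃ : dL ≤ B₃) (h1 : 2 * B₀ * C₁ * B₃ * ε₁ ≤ ε₄)
    (h2 : 4 * ε₄ ≤ a₃) (h3 : 16 * B₀ * C₄ * ε₄ ≤ 1) (H₁ : GaugeField P j SU2 → (ℬ →L[ℂ] 𝒴))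
    (hH₁ : ∀ V B, ‖H₁ V B‖ ≤ B₀ * ‖B‖)
    -- ══ R10 SUPPLIED (this file): the u-tuple's coarse-datum map IS a bounded complex-LINEAR map `T V` read on the chart
    -- coordinates — its three analytic binders `hΦd hΦ0 hΦ` are DISCHARGED (`ShellMeasureLinearChartMap`); DISPLAYED in
    -- their place: ONE number relation «operator norm × polydisc radius < B11's `b = 2dLC₁ε₁`» ══
    (T : GaugeField P j SU2 → ((Fin m₀ → ℂ) →L[ℂ] ℬ)) {rΦ : ℝ} (hTb : ∀ V, ‖T V‖ * rΦ < 2 * dL * C₁ * ε₁)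
    (hSr : S < rΦ)
    -- ══ R11 SUPPLIED (row S99, γ14): the THREE Landau-correction letters ARE the tree's `C_k` of [B7] Prop. 4 in the
    -- `A`-currency (S64 `landauCf`), all with `C₂ := C2cov d`, `RC := landauRad d L`: u-tuple (LOCALIZED, flat background —
    -- its plaquette variables are words of the exponent field alone) `Cf V := (ball 0 RC).indicator (C_k(1, ·))`, NOTHING
    -- displayed in its place; w-tuple (GLOBAL minimiser, flat pi-types) `Cw V := landauCfBox L (Ubg V) k Sw Sw′ RC` (cut off
    -- PER OUTPUT BOND on its box — exact locality `hlocC` by `landauCfBox_local`); e-tuple (GLOBAL minimiser, pinned) `Ce V :=`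
    -- CfP's conjugate of `C_k(Ubg V, ·)` with `C₂e := C2cov d·e^{2δ′r₀e}`.  `hC₂ hCq hCd hCr h𝓡𝒳 ∕ hC₂w hCqw hCdw hlocC hCrw h𝓡𝒳w
    -- ∕ hC₂e hCqe hCde` DISCHARGED (f1 §5, f3a §2–§3).  DISPLAYED IN THEIR PLACE (w∕e only): the global minimiser's background
    -- `Ubg V` on `ℤᵈ` (unitary-valued) and its plaquette regularity ON THE BOXES of the two output index sets ONLY — `h52locw`,
    -- `h52loce` (B11 Thm 1 ∕ (19)–(21) TYPE, class T until node O reads it off the co-tests) — four LEVEL-FREE numbers on `α₀`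
    -- (class D), the e-letter's two pin profiles with CfP's reach `r₀e` ([R]); [dict]: `k` = the slot's level ══
    (k : ℕ) (Sf Sf' Sw Sw' : Finset (B7Prop1Explicit.Site P.d × Fin P.d))
    (Ubg : GaugeField P j SU2 → B7Prop1Explicit.Site P.d → Fin P.d → 𝔸ˣ) (hUbg : ∀ V x κ, Ubg V x κ ∈ unitaryUnits 𝔸)
    {α₀ : ℝ} (hα : 0 < α₀) (hα3 : C0 P.d * α₀ ≤ 1 / 3) (hα4 : 4 * α₀ ≤ c2' P.d P.L) (hα6 : 4 * O1cov P.d * α₀ ≤ 1 / 3)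
    (h52locw : ∀ V (c : ↥Sw'),
      pdevOn (loK P.L k c.1.1) (bondHiK P.L k c.1.1 c.1.2) (Ubg V) < α₀ * (((P.L : ℝ) ^ k)⁻¹) ^ 2)
    (ιs : GaugeField P j SU2 → (𝒴 →L[ℂ] (↥Sf → 𝔸))) (hι : ∀ V Y, ‖ιs V Y‖ ≤ ‖Y‖)
    (Hop : GaugeField P j SU2 → ((↥Sf' → 𝔸) →L[ℂ] 𝒴)) (hH : ∀ V X, ‖Hop V X‖ ≤ B₀ * ‖X‖) {ε₃ : ℝ}
    (h18 : 18 * C2cov P.d * B₀ * ε₃ ≤ 1) (hcoup : ε₄ + B₀ * (2 * dL * C₁ * ε₁) ≤ ε₃)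
    (h3R : 3 * ε₃ ≤ landauRad P.d P.L) (ℓs : ι → List (𝒴 →L[ℂ] Matrix n n ℂ)) {κr : ℝ} (hκ : 0 ≤ κr)
    (hℓ : ∀ p ∈ Pu, ∀ ℓ ∈ ℓs p, ∀ Y, ‖ℓ Y‖ ≤ κr * ‖Y‖) {m : ℕ} (hlen : ∀ p ∈ Pu, (ℓs p).length ≤ m) {κc : ℝ}
    (hκc : 0 ≤ κc) (hcurl : ∀ p ∈ Pu, ∀ Y, ‖((ℓs p).map fun ℓ => ℓ Y).sum‖ ≤ κc * ‖Y‖)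
    -- ══ (T2) THE WILSON SLOT'S SUPPLIER DATA AT THE READING OF RECORD (file 4
    -- `ShellMeasureLandauWilsonSquaresKernelsSchwarz.hE_landau_wilsonSquares_located_schwarz_of_decay`, per exterior section `V`,
    -- V-uniform constants): five FLAT pi-type chain spaces, ONE pin profile on a common position space (one-sided Lipschitz),
    -- the four linear letters as V-indexed DECAY KERNELS with reduced-rate row sums ((3.133)∕Thm 3.3, (46), (103) decay-halves
    -- TYPE — LOCATORS), the flat printed-TYPE lists, two localities with reaches, the block support of the coarse field, blind
    -- flat read-outs, the located count — NOTHING PINNED DISPLAYED; the Wilson budget LOCATED and SECOND ORDER (γ6) ══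
    {Λw Λz Λb 𝔖 : Type*} [Fintype Λw] [DecidableEq Λw] [Fintype Λz] [Fintype Λb] {𝔄w ℭ 𝔇 : Type*}
    [NormedAddCommGroup 𝔄w] [NormedSpace ℂ 𝔄w] [CompleteSpace 𝔄w] [NormedAddCommGroup ℭ] [NormedSpace ℂ ℭ]
    [NormedAddCommGroup 𝔇] [NormedSpace ℂ 𝔇] {δw : ℝ} (hδw : 0 ≤ δw) (ϖw : 𝔖 → ℝ) (dis : 𝔖 → 𝔖 → ℝ)
    (hϖw : ∀ x y, ϖw x ≤ ϖw y + dis x y)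
    -- ══ R06∕R09 w-TUPLE SUP-NORM ROWS SUPPLIED (this file): ONE structural sign row on the position distance ══
    (hdis : ∀ x y, 0 ≤ dis x y) (pos : Λw → 𝔖) (posz : Λz → 𝔖) (pos' : ↥Sw → 𝔖) (posx : ↥Sw' → 𝔖) (posb : Λb → 𝔖)
    (k𝒢 : GaugeField P j SU2 → Λw → Λz → (ℭ →L[ℂ] 𝔄w)) (kι : GaugeField P j SU2 → ↥Sw → Λw → (𝔄w →L[ℂ] 𝔸))
    (kH : GaugeField P j SU2 → Λw → ↥Sw' → (𝔸 →L[ℂ] 𝔄w)) (kH₁ : GaugeField P j SU2 → Λw → Λb → (𝔇 →L[ℂ] 𝔄w))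
    {c𝒢 δ𝒢 M𝒢 cι δι Mι cH δH MH cH₁ δH₁ MH₁ : ℝ} (hc𝒢 : 0 ≤ c𝒢) (hM𝒢 : 0 ≤ M𝒢)
    (hk𝒢 : ∀ V c b', ‖k𝒢 V c b'‖ ≤ c𝒢 * Real.exp (-(δ𝒢 * dis (pos c) (posz b'))))
    (hM𝒢' : ∀ x, ∑ b', Real.exp (-((δ𝒢 - δw) * dis x (posz b'))) ≤ M𝒢) (hcι : 0 ≤ cι) (hMι : 0 ≤ Mι)
    (hkι : ∀ V c b', ‖kι V c b'‖ ≤ cι * Real.exp (-(δι * dis (pos' c) (pos b'))))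
    (hMι' : ∀ x, ∑ b', Real.exp (-((δι - δw) * dis x (pos b'))) ≤ Mι) (hcH : 0 ≤ cH) (hMH : 0 ≤ MH)
    (hkH : ∀ V c b', ‖kH V c b'‖ ≤ cH * Real.exp (-(δH * dis (pos c) (posx b'))))
    (hMH' : ∀ x, ∑ b', Real.exp (-((δH - δw) * dis x (posx b'))) ≤ MH) (hcH₁ : 0 ≤ cH₁) (hMH₁ : 0 ≤ MH₁)
    (hkH₁ : ∀ V c b', ‖kH₁ V c b'‖ ≤ cH₁ * Real.exp (-(δH₁ * dis (pos c) (posb b'))))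
    (hMH₁' : ∀ x, ∑ b', Real.exp (-((δH₁ - δw) * dis x (posb b'))) ≤ MH₁)
    -- the flat lists (P4)∕(118)∕(121)∕(75)-TYPE∕(44) at radius `RCw` with `6(ε₄w + B₀w·bw) ≤ RCw`∕scaling∕(54); ══ THIS FILE: the
    -- three sup-norm operator rows `h𝒢w hH₁w hHw` of S104 f4 are DERIVED (Schur test of the decay rows above) — in their place the
    -- NUMBER JUNCTIONS `c𝒢·M𝒢 ≤ B₀w`, `cH₁·MH₁ ≤ B₀w`, `cH·MH ≤ B₀w` ══
    (W𝒱w : GaugeField P j SU2 → (Λw → 𝔄w) → (Λz → ℭ)) {B₀w C₄w a₃w ε₄w bw : ℝ} (hWw : ∀ V, Prop4Hyp (W𝒱w V) C₄w a₃w)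
    (hB₀w : 0 < B₀w) (hC₄w : 0 ≤ C₄w) (hε₄w : 0 ≤ ε₄w) (hdomw : 2 * (ε₄w + B₀w * bw) ≤ a₃w)
    (hselfw : B₀w * C₄w * (ε₄w + B₀w * bw) ^ 2 ≤ ε₄w) (hcontrw : 4 * B₀w * C₄w * (ε₄w + B₀w * bw) < 1)
    -- ══ R10 SUPPLIED: the w-tuple's coarse-datum map is a bounded LINEAR map into the flat pi-type; ONE number relation ══
    (Tw : GaugeField P j SU2 → ((Fin m₀ → ℂ) →L[ℂ] (Λb → 𝔇))) {rΦw : ℝ} (hTbw : ∀ V, ‖Tw V‖ * rΦw < bw)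
    (h2Sw : 2 * S ≤ rΦw) (hιw : ∀ V Y, ‖kerOp (kι V) Y‖ ≤ ‖Y‖) (hqw : 9 * C2cov P.d * B₀w * (ε₄w + B₀w * bw) < 1)
    (hRCw : 6 * (ε₄w + B₀w * bw) ≤ landauRad P.d P.L)
    -- localities with reaches, the block support, the two contraction numbers (DISPLAYED arithmetic on the decay constants)
    (NW : Λz → Λw → Prop)
    (hlocW : ∀ V, ∀ A A' : Λw → 𝔄w, ∀ c', (∀ b', NW c' b' → A b' = A' b') → W𝒱w V A c' = W𝒱w V A' c') {rW : ℝ}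
    (hreachW : ∀ c' b', NW c' b' → ϖw (posz c') - rW ≤ ϖw (pos b')) {rC : ℝ}
    (hreachC : ∀ (c' : ↥Sw') (b' : ↥Sw),
      BondIn (loK P.L k c'.1.1) (bondHiK P.L k c'.1.1 c'.1.2) b'.1.1 b'.1.2 → ϖw (posx c') - rC ≤ ϖw (pos' b'))
    (hsupp : ∀ V, ∀ z : Fin m₀ → ℂ, ∀ i, 0 < ϖw (posb i) → Tw V z i = 0)
    (hqW : c𝒢 * M𝒢 * (4 * C₄w * (ε₄w + B₀w * bw) * Real.exp (δw * rW)) < 1)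
    (hk : 12 * C2cov P.d * (ε₄w + B₀w * bw) * Real.exp (δw * rC) * (cι * Mι) * (cH * MH) < 1)
    -- weight plaquettes; read-outs BLIND off located supports, FLAT op-norms, curl op-norm (DISPLAYED; `κ_c ∝ η²`), lengths
    {𝔭 : Type*} (Pw : Finset 𝔭) (ℓw : 𝔭 → List ((Λw → 𝔄w) →L[ℂ] Matrix n n ℂ)) (suppw : 𝔭 → Finset Λw) (ϖPw : 𝔭 → ℝ)
    (hblindw : ∀ p ∈ Pw, ∀ ℓ ∈ ℓw p, ∀ A A' : Λw → 𝔄w, (∀ b' ∈ suppw p, A b' = A' b') → ℓ A = ℓ A')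
    (hdepthw : ∀ p ∈ Pw, ∀ b' ∈ suppw p, ϖPw p ≤ ϖw (pos b')) (hϖPw : ∀ p ∈ Pw, 0 ≤ ϖPw p) {κwb κcb : ℝ}
    (hκwb : 0 ≤ κwb) (hκcb : 0 ≤ κcb) (hℓwb : ∀ p ∈ Pw, ∀ ℓ ∈ ℓw p, ‖ℓ‖ ≤ κwb) (hcurlw : ∀ p ∈ Pw, ‖(ℓw p).sum‖ ≤ κcb)
    {mw : ℕ} (hlenw : ∀ p ∈ Pw, (ℓw p).length ≤ mw)
    -- the global tuple's real structure with SKEW weight read-outs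
    (𝓡𝒴w : AddSubgroup (Λw → 𝔄w)) (h𝓡𝒴w : IsClosed (𝓡𝒴w : Set (Λw → 𝔄w))) (𝓡𝒵w : AddSubgroup (Λz → ℭ))
    (𝓡ℬw : AddSubgroup (Λb → 𝔇)) (h𝒢rw : ∀ V, ∀ f ∈ 𝓡𝒵w, kerOp (k𝒢 V) f ∈ 𝓡𝒴w) (hWrw : ∀ V, ∀ Y ∈ 𝓡𝒴w, W𝒱w V Y ∈ 𝓡𝒵w)
    (hιrw : ∀ V, ∀ Y ∈ 𝓡𝒴w, kerOp (kι V) Y ∈ skewPi ↥Sw)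
    (hHrw : ∀ V, ∀ X ∈ skewPi (𝔸 := 𝔸) ↥Sw', kerOp (kH V) X ∈ 𝓡𝒴w) (hH₁rw : ∀ V, ∀ B ∈ 𝓡ℬw, kerOp (kH₁ V) B ∈ 𝓡𝒴w)
    (hTrw : ∀ V (y : Fin m₀ → ℝ), Tw V (cplx y) ∈ 𝓡ℬw)
    (hskew : ∀ p ∈ Pw, ∀ ℓ ∈ ℓw p, ∀ Y ∈ 𝓡𝒴w, ℓ Y ∈ skewAdjoint (Matrix n n ℂ))
    -- the frozen background plaquettes (N-ne7cp1-g31-2) with a uniform size bound, the located count, `0 ≤ β`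
    (Bp : GaugeField P j SU2 → 𝔭 → Matrix n n ℂ) {d : 𝔭 → ℝ} {dbar : ℝ}
    (hBu : ∀ V, ∀ p ∈ Pw, Bp V p ∈ unitary (Matrix n n ℂ)) (hBd : ∀ V, ∀ p ∈ Pw, ‖Bp V p - 1‖ ≤ d p)
    (hd : ∀ p ∈ Pw, d p ≤ dbar) (hdbar : 0 ≤ dbar) {Kw : ℝ} (hKw : ∑ p ∈ Pw, Real.exp (-(δw * ϖPw p)) ≤ Kw)
    -- ══ (T3) THE LOCATED NON-WILSON TERMS — THE 𝓔-LEG READ OFF THE w-TUPLE's KERNELS IN THE PINNED DRESS (S113, leaf-01-g11: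
    -- `hE_landau_chartRay_pinned_w`): ONE exponent field; the e-tuple's carriers and letters are GONE; ENTERING the pin sign, the three
    -- Schur number junctions (S108's rows, born here) and the pinned restriction row; the e-leg's own numbers, its Landau-correction
    -- pair (between the pinned spaces), the TERM rows and the coupling STAY ══
    (hϖ0 : ∀ x, 0 ≤ ϖw x) (hB𝒢w : c𝒢 * M𝒢 ≤ B₀w) (hBH₁w : cH₁ * MH₁ ≤ B₀w) (hBHw : cH * MH ≤ B₀w) {ε₄e : ℝ}
    (hε₄e : 0 ≤ ε₄e) (hdome : 2 * (ε₄e + B₀w * bw) ≤ a₃w)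
    (hselfe : B₀w * (C₄w * Real.exp (δw * rW)) * (ε₄e + B₀w * bw) ^ 2 ≤ ε₄e)
    (hcontre : 4 * B₀w * (C₄w * Real.exp (δw * rW)) * (ε₄e + B₀w * bw) < 1)
    (hιew : ∀ V, ∀ Y : WSup (pinW δw (ϖw ∘ pos)) 1 𝔄w, ‖kerOpPin (kι V) δw (ϖw ∘ pos) (ϖw ∘ pos') Y‖ ≤ ‖Y‖)
    (hqe : 9 * (C2cov P.d * Real.exp (2 * δw * rC)) * B₀w * (ε₄e + B₀w * bw) < 1)
    (hRCe : 3 * (ε₄e + B₀w * bw) ≤ landauRad P.d P.L) {𝔱 : Type*} (I : Finset 𝔱) {Ef : 𝔱 → (Λw → 𝔄w) → ℂ} {rE : ℝ}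
    {ee : 𝔱 → ℝ} (hrE : 0 < rE) (hEd : ∀ i ∈ I, DifferentiableOn ℂ (Ef i) (ball 0 rE))
    (hEb : ∀ i ∈ I, ∀ Z ∈ ball (0 : Λw → 𝔄w) rE, ‖Ef i Z‖ ≤ ee i) (supp : 𝔱 → Finset Λw)
    (hblind : ∀ i ∈ I, ∀ A₁ A₂ : Λw → 𝔄w, (∀ b' ∈ supp i, A₁ b' = A₂ b') → Ef i A₁ = Ef i A₂) (ϖP : 𝔱 → ℝ)
    (hdepth : ∀ i ∈ I, ∀ b' ∈ supp i, ϖP i ≤ ϖw (pos b')) {LK : ℝ}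
    (hK : ∑ i ∈ I, 2 * ee i / rE * Real.exp (-(δw * ϖP i)) ≤ LK)
    (hcoupE : ((ε₄e + B₀w * bw) + B₀w * (4 * (C2cov P.d * Real.exp (2 * δw * rC)) * (ε₄e + B₀w * bw) ^ 2)) ≤ rE / 2)
    -- ══ (S78) THE FLUCTUATION-DRESSED TERMS: `−log ∫ g e^{A} dμ` with an ω-UNIFORM ray constant `B_d`, integrability and
    -- positivity of the dressed integral, a lower bound on the S-ball (all DISPLAYED) ══
    {Ω : Type*} [MeasurableSpace Ω] (μ : Measure Ω) {g : Ω → ℝ} (hg : ∀ ω, 0 ≤ g ω)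
    (A : GaugeField P j SU2 → (Fin m₀ → ℝ) → Ω → ℝ) {Bd : ℝ}
    (hint : ∀ V, ∀ x ∈ closedBall (0 : Fin m₀ → ℝ) S, ∀ c : ℝ, 1 / 2 ≤ c → c ≤ 1 →
      Integrable (fun ω => g ω * Real.exp (A V (c • x) ω)) μ)
    (hpos : ∀ V, ∀ x ∈ closedBall (0 : Fin m₀ → ℝ) S, ∀ c : ℝ, 1 / 2 ≤ c → c ≤ 1 →
      0 < ∫ ω, g ω * Real.exp (A V (c • x) ω) ∂μ)
    (hA : ∀ V, ∀ x ∈ closedBall (0 : Fin m₀ → ℝ) S, ∀ c : ℝ, 1 / 2 ≤ c → c ≤ 1 →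
      ∀ ω, A V x ω ≤ A V (c • x) ω + (1 - c) * Bd)
    {BE₂ : ℝ} (hElb₂ : ∀ V (y : Fin m₀ → ℝ), ‖y‖ ≤ S → -BE₂ ≤ (-Real.log (∫ ω, g ω * Real.exp (A V y ω) ∂μ)))
    (L : Set (𝒴 →L[ℂ] Matrix n n ℂ)) (𝓡𝒵 : AddSubgroup 𝒵) (𝓡ℬ : AddSubgroup ℬ)
    (h𝒢r : ∀ V, ∀ f ∈ 𝓡𝒵, 𝒢 V f ∈ readOutReal L) (hWr : ∀ V, ∀ Y ∈ readOutReal L, W𝒱 V Y ∈ 𝓡𝒵)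
    (hιr : ∀ V, ∀ Y ∈ readOutReal L, ιs V Y ∈ skewPi ↥Sf)
    (hHr : ∀ V, ∀ X ∈ skewPi (𝔸 := 𝔸) ↥Sf', Hop V X ∈ readOutReal L) (hH₁r : ∀ V, ∀ B ∈ 𝓡ℬ, H₁ V B ∈ readOutReal L)
    (hTr : ∀ V (y : Fin m₀ → ℝ), T V (cplx y) ∈ 𝓡ℬ)
    (hudict : ∀ V, ∀ x ∈ cube m₀ S,
      u (fixTo (combBonds lo hi) 1 (updateFinset V Λ (expFibreChart Λ 1 e x))) =
        classifier hPu (fun p => holOf (ℓs p) (fun y => landauExp ((ball (0 : ↥Sf → 𝔸) (landauRad P.d P.L)).indicator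
            (landauCf P.L (1 : B7Prop1Explicit.Site P.d → Fin P.d → 𝔸ˣ) k Sf Sf')) (ιs V) (Hop V)
          (4 * C2cov P.d * (ε₄ + B₀ * (2 * dL * C₁ * ε₁)) ^ 2)
          (solAt (𝒢 V) 0 (W𝒱 V) ε₄ (0 : 𝒵) (H₁ V (T V (cplx y))) + H₁ V (T V (cplx y))))) x)
    (hRdict : ∀ V, ∀ x ∈ cube m₀ S, F (fixTo (combBonds lo hi) 1 (updateFinset V Λ (expFibreChart Λ 1 e x))) =
      (closedBall (0 : Fin m₀ → ℝ) S ∩ ⋂ i ∈ N, {y | classifier (hPuN i) (holN i V) y < θN i}).indicator (1 :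
      (Fin m₀ → ℝ) → ℝ≥0∞) x * ENNReal.ofReal (Real.exp (-((∑ p ∈ Pw, β * (1 - (Matrix.trace (Bp V p * holOf (ℓw
      p) (fun y => landauExp (landauCfBox P.L (Ubg V) k Sw Sw' (landauRad P.d P.L)) (kerOp (kι V)) (kerOp (kH
      V)) (4 * C2cov P.d * (ε₄w + B₀w * bw) ^ 2) (solAt (kerOp (k𝒢 V)) 0 (W𝒱w V) ε₄w (0 : Λz → ℭ) (kerOp (kH₁ V)
      (Tw V (cplx y))) + kerOp (kH₁ V) (Tw V (cplx y)))) x)).re / Fintype.card n)) + ((∑ i ∈ I, Ef i (WSup.toPiL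
      (pinW δw (ϖw ∘ pos)) 1 (landauExp (fun Y : WSup (pinW δw (ϖw ∘ pos')) 1 𝔸 => ((toPiL (pinW δw (ϖw ∘ posx))
      1).symm (landauCfBox P.L (Ubg V) k Sw Sw' (landauRad P.d P.L) (toPiL (pinW δw (ϖw ∘ pos')) 1 Y)) : WSup
      (pinW δw (ϖw ∘ posx)) 1 𝔸)) (kerOpPin (kι V) δw (ϖw ∘ pos) (ϖw ∘ pos')) (kerOpPin (kH V) δw (ϖw ∘ posx)
      (ϖw ∘ pos)) (4 * (C2cov P.d * Real.exp (2 * δw * rC)) * (ε₄e + B₀w * bw) ^ 2) (solAt (kerOpPin (k𝒢 V) δw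
      (ϖw ∘ posz) (ϖw ∘ pos)) 0 (fun Y : WSup (pinW δw (ϖw ∘ pos)) 1 𝔄w => ((toPiL (pinW δw (ϖw ∘ posz)) 1).symm
      (W𝒱w V (toPiL (pinW δw (ϖw ∘ pos)) 1 Y)) : WSup (pinW δw (ϖw ∘ posz)) 1 ℭ)) ε₄e (0 : WSup (pinW δw (ϖw ∘
      posz)) 1 ℭ) (kerOpPin (kH₁ V) δw (ϖw ∘ posb) (ϖw ∘ pos) ((toPiL (pinW δw (ϖw ∘ posb)) 1).symm (Tw V (cplx
      x)))) + kerOpPin (kH₁ V) δw (ϖw ∘ posb) (ϖw ∘ pos) ((toPiL (pinW δw (ϖw ∘ posb)) 1).symm (Tw V (cplx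
      x))))))).re + (-Real.log (∫ ω, g ω * Real.exp (A V x ω) ∂μ)))))))
    (hδ0 : 0 ≤ δ) (hδ1 : δ < 1) (hρ0 : 0 ≤ ρ) (hρ : ρ ≤ (1 - δ) / 2) (hβ : 0 ≤ β)
    -- SM-L2 (SM) DISCHARGED IN THE STOKES CURRENCY (S73 `hSM_of_stokes`): the η-scalings of the classifier's read-out data
    -- DISPLAYED — curl read-out × field size `κ_c·z̄ ≤ c₁η²z` (B11 (25)∕(37) TYPE), letter size `κ_r·z̄ ≤ c₂ηz` ((19) TYPE),
    -- regime `m·κ_r·z̄ ≤ 1` — the UNIT-currency smallness `36(c₁z + m²c₂²z²)∕(r_Φ∕S − 1)² ≤ δ·εθ`, and the classifier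
    -- threshold `θ := εθ·η²` (B14 (2.17) TYPE): the `η²` CANCELS
    {η εθ c₁ c₂ z : ℝ} (hη : 0 < η) (hεθ : 0 < εθ)
    (hs₁ : κc * ((ε₄ + B₀ * (2 * dL * C₁ * ε₁)) + B₀ * (4 * C2cov P.d * (ε₄ + B₀ * (2 * dL * C₁ * ε₁)) ^ 2)) ≤ c₁ * η ^ 2 * z)
    (ha : κr * ((ε₄ + B₀ * (2 * dL * C₁ * ε₁)) + B₀ * (4 * C2cov P.d * (ε₄ + B₀ * (2 * dL * C₁ * ε₁)) ^ 2)) ≤ c₂ * η * z)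
    (hma : m * (κr * ((ε₄ + B₀ * (2 * dL * C₁ * ε₁)) + B₀ * (4 * C2cov P.d * (ε₄ + B₀ * (2 * dL * C₁ * ε₁)) ^ 2))) ≤ 1)
    (hsm : 36 * (c₁ * z + m ^ 2 * c₂ ^ 2 * z ^ 2) / (rΦ / S - 1) ^ 2 ≤ δ * εθ)
    -- THE DISPLAYED γ3 INPUT OF RECORD (N-ne7cp1-g32-2 ∕ N-ne7cp1-g33-2 «COLLAR»; leaf-01-g8 l.18489, leaf-08-g14 l.18568):
    -- radius `(d−1)·nb·a ≤ 2 sin(S∕2)`, a cover of the box plaquettes by a CORE set (⊇ the plaquettes of `□^∼`) and a COLLAR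
    -- set, and the PAIR of readings — «sub-threshold ⟹ core plaquettes `a`-small» (B14 (2.16)–(2.17) + average regularity
    -- [Balaban1985Averaging] Props 1∕2 TYPE, from `u < θ`) and «`F ≠ 0` ⟹ collar plaquettes `a`-small» (the density's KEPT
    -- co-tests, B15 (1.3)–(1.9) TYPE — a SUPPORT property); located, NOT asserted — REPLACE `hreach′` of file 1 (hence
    -- `hFsupp` of S80 f3); binder NAMES = S87 f4's (`hn hN hΛbox hΛcomb ha0 hrad hcover hcore hcollar`; the two plaquette
    -- sets are called `Pcore`∕`Pcollar` here because S80 f3 already uses `A` for the (S78) dressed action)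
    {a : ℝ} (ha0 : 0 ≤ a) (hrad : ((P.d - 1 : ℕ) : ℝ) * nb * a ≤ 2 * Real.sin (S / 2))
    {Pcore Pcollar : Set (Plaq P j)} (hcover : boxPlaqs lo hi ⊆ Pcore ∪ Pcollar)
    (hcore : ∀ (V : GaugeField P j SU2) (y : ↥Λ → SU2),
      u (fixTo (combBonds lo hi) 1 (updateFinset V Λ y)) < εθ * η ^ 2 →
        PlaqSmallOn Pcore a (fixTo (combBonds lo hi) 1 (updateFinset V Λ y)))
    (hcollar : ∀ (V : GaugeField P j SU2) (y : ↥Λ → SU2),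
      F (fixTo (combBonds lo hi) 1 (updateFinset V Λ y)) ≠ 0 →
        PlaqSmallOn Pcollar a (fixTo (combBonds lo hi) 1 (updateFinset V Λ y))) :
    SlotAntiConcentration ((fieldMeasure P j SU2).withDensity F) u (εθ * η ^ 2) ρ
      (2 * ((m₀ : ℝ) + (3 * (|β| * ((dbar +
          2 * (κcb * (cH₁ * MH₁ * bw / ((1 - c𝒢 * M𝒢 * (4 * C₄w * (ε₄w + B₀w * bw) * Real.exp (δw * rW))) *
              (1 - 12 * C2cov P.d * (ε₄w + B₀w * bw) * Real.exp (δw * rC) * (cι * Mι) * (cH * MH)))) +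
            expTail₂ (mw * (κwb * (cH₁ * MH₁ * bw / ((1 - c𝒢 * M𝒢 * (4 * C₄w * (ε₄w + B₀w * bw) * Real.exp (δw * rW))) *
              (1 - 12 * C2cov P.d * (ε₄w + B₀w * bw) * Real.exp (δw * rC) * (cι * Mι) * (cH * MH))))))) / (rΦw / S)) *
          (2 * (κcb * (cH₁ * MH₁ * bw / ((1 - c𝒢 * M𝒢 * (4 * C₄w * (ε₄w + B₀w * bw) * Real.exp (δw * rW))) *
              (1 - 12 * C2cov P.d * (ε₄w + B₀w * bw) * Real.exp (δw * rC) * (cι * Mι) * (cH * MH)))) +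
            expTail₂ (mw * (κwb * (cH₁ * MH₁ * bw / ((1 - c𝒢 * M𝒢 * (4 * C₄w * (ε₄w + B₀w * bw) * Real.exp (δw * rW))) *
              (1 - 12 * C2cov P.d * (ε₄w + B₀w * bw) * Real.exp (δw * rC) * (cι * Mι) * (cH * MH))))))) / (rΦw / S))) * Kw) +
        (3 * (LK * (2 * ((ε₄e + B₀w * bw) + B₀w * (4 * (C2cov P.d * Real.exp (2 * δw * rC)) * (ε₄e + B₀w * bw) ^ 2)))) / (rΦw / S - 1) + Bd))) / (1 - δ)) := by
  haveI : CompleteSpace (WSup (pinW δw (ϖw ∘ posx)) 1 𝔸) := completeSpace_wsup _ 1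
  have hL2 : 2 ≤ P.L := P.hL.2
  have hC2e : 0 ≤ C2cov P.d * Real.exp (2 * δw * rC) := mul_nonneg (C2cov_nonneg P.d) (Real.exp_pos _).le
  -- v6: the 𝓔-leg's pinned Landau-correction pair = the w-tuple's box-local pair through the w-tuple's own pins (S99 f3b′ VERBATIM)
  have hRw := fun V : GaugeField P j SU2 =>
    ShellMeasureLandauCfBoxLocal.landauCfBox_real_binders_local hL2 k (Ubg V) (hUbg V) hα hα3 hα4 hα6 Sw Sw' (h52locw V)
  have hRe := fun V : GaugeField P j SU2 =>
    conj_binders_of_local (𝔅 := 𝔸) hδw (fun b => hϖ0 (pos' b)) (fun c => hϖ0 (posx c))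
      (fun (c' : ↥Sw') (b' : ↥Sw) => BondIn (loK P.L k c'.1.1) (bondHiK P.L k c'.1.1 c'.1.2) b'.1.1 b'.1.2)
      (fun A A' c' h => ShellMeasureLandauCfBoxLocal.landauCfBox_local P.L (Ubg V) k Sw Sw' (landauRad P.d P.L) A A' c' h)
      hreachC (C2cov_nonneg P.d) (hRw V).1 (hRw V).2.1
  -- `hElb₁` DERIVED at `BE₁ := Σ_{i∈I} ee i` by S113 f2 `hElb_landau_chartRay_pinned_w` (leaf-01-g11: S108 f3a fired at the
  -- w-instances), per exterior section; R10's LINEAR `Tw` with `hTbw`; the located coupling `hcoupE` is load-bearing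
  have hElb₁ := fun V : GaugeField P j SU2 =>
    ShellMeasureRayTermsPinnedLandauW.hElb_landau_chartRay_pinned_w hδw ϖw hϖ0 dis hϖw pos posz pos' posx posb hS (k𝒢 V)
      (kH₁ V) (kH V) hc𝒢 hM𝒢 (hk𝒢 V) hM𝒢' hcH hMH (hkH V) hMH' hcH₁ hMH₁ (hkH₁ V) hMH₁' hB𝒢w hBH₁w hBHw hB₀w (W𝒱w V)
      (hWw V) hC₄w NW (hlocW V) hreachW (ShellMeasureLinearChartMap.hΦd_of_linear Tw rΦw V)
      (ShellMeasureLinearChartMap.hΦ0_of_linear Tw V) (ShellMeasureLinearChartMap.hΦ_of_linear Tw hTbw V) (by linarith)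
      (hsupp V) hε₄e hdome hselfe hcontre hC2e (hRe V).1 (hRe V).2 (kι V) (hιew V) hqe hRCe I hEb hcoupE
  exact 
slotAC_realized_su2_landauChart_assembled_decay_v6_cfB7_lin_coTests_schur hn hN Λ hΛbox hΛcomb e hS hSπ hF hFi hu
    hui hPu N hPuN holN hRN hθN hδ0N hδ1N hSMN hANN 𝒢 W𝒱 h𝒢 hW hB₀ hC₄ hε₄ hdL hC₁ hε₁ hB₃ h1 h2 h3 H₁ hH₁ T hTb hSr k
    Sf Sf' Sw Sw' Ubg hUbg hα hα3 hα4 hα6 h52locw ιs hι Hop hH h18 hcoup h3R ℓs hκ hℓ hlen hκc hcurl hδw ϖw dis hϖw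
    hdis pos posz pos' posx posb k𝒢 kι kH kH₁ hc𝒢 hM𝒢 hk𝒢 hM𝒢' hcι hMι hkι hMι' hcH hMH hkH hMH' hcH₁ hMH₁ hkH₁ hMH₁'
    W𝒱w hWw hB₀w hC₄w hε₄w hdomw hselfw hcontrw Tw hTbw h2Sw hιw hqw hRCw NW hlocW hreachW hreachC hsupp hqW hk Pw ℓw
    suppw ϖPw hblindw hdepthw hϖPw hκwb hκcb hℓwb hcurlw hlenw 𝓡𝒴w h𝓡𝒴w 𝓡𝒵w 𝓡ℬw h𝒢rw hWrw hιrw hHrw hH₁rw hTrw hskew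
    Bp hBu hBd hd hdbar hKw hϖ0 hB𝒢w hBH₁w hBHw hε₄e hdome hselfe hcontre hιew hqe hRCe I hrE hEd hEb supp hblind ϖP
    hdepth hK hcoupE hElb₁ μ hg A hint hpos hA hElb₂ L 𝓡𝒵 𝓡ℬ h𝒢r hWr hιr hHr hH₁r hTr hudict hRdict hδ0 hδ1 hρ0 hρ hβ
    hη hεθ hs₁ ha hma hsm ha0 hrad hcover hcore hcollar

end Box

end Summit.QuantumFields.BalabanUV.T4Continuum.ShellMeasureLandauEndAssembledDecayCfLinCoTestsSchurElbV6

end
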